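/-
Copyright (c) 2026 the pub-hodgecm-mathlib formalisation cell (harness21).  Prover seat hodgecm-mathlib-K2Liu-p13 (g4), Track B «K2-LIT»,
#184♮ = hLiu418 = `stmt-HodgeConjecture-24832`; ROAD Φ (RULING «M-156n»), #41 TOP — the (β) scalar letters ★ (E7) p861991 ∕ ★ (E7′) p862028 ∕ ★ (E7″) p862064 READ AT THE
SOCKET'S CHARACTER OF RECORD `χ = toHeckeCharacter L lam⁻¹`, `lam` conjugate-symplectic: the parity letter `hχε` (`χ(a_L) = ε_{L∕L⁺}(a)`, ★ HKS (1.5) at `m = 1` via ★ `IsConjugateSymplectic.inv`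
+ ★ `isOscillatorChar_toHeckeCharacter_iff`) and the unitarity letter `hχu` of the local components DISCHARGED — so every finite-place scalar letter of
★ `exists_bigCell_continuation_cm_of_faces` is available for the TOP's own `(lam, hlam)` with NO character hypothesis.
THEOREMS ONLY (no `def`, no `instance`, no named-fact hypothesis, no `sorry`).
-/
import Summits.HodgeConjecture.HodgeConjecture.Theorems.K2LiuSiegelNormaliserTwoValue       -- ★ (E7) `aNorm_two_localComponent_eq_localScalar_cm`
import Summits.HodgeConjecture.HodgeConjecture.Theorems.K2LiuSiegelNormaliserTwoRamified    -- ★ (E7′) `differentiableOn_aNorm_two_localComponent_cm_of_ramified`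
import Summits.HodgeConjecture.HodgeConjecture.Theorems.K2LiuSiegelNormaliserTwoModified    -- ★ (E7″) `invLocalScalar_mul_aNorm_two_eq_cm`, `differentiableOn_modifiedNormaliser_cm`
import Summits.HodgeConjecture.HodgeConjecture.Theorems.K2LiuConjugateSymplecticInv         -- ★ `IsConjugateSymplectic.inv`
import Literature.RepresentationTheory.Liu2021.OscillatorConventions                        -- ★ `isOscillatorChar_toHeckeCharacter_iff` (HKS (1.5), `m = 1`)
import Literature.NumberTheory.Automorphic.IdeleClassCharacterHecke                         -- ★ `toHeckeCharacter`, `isUnitary_toHeckeCharacter`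
import HarnessLib

/-!
# Crux `HLiu418`, ROAD Φ, organ Φ8 (row G6): THE `n = 2` NORMALISER LETTERS AT THE CHARACTER OF RECORD `χ = toHeckeCharacter L lam⁻¹`

Cell `hodgecm-mathlib`, crux item hLiu418 = `stmt-HodgeConjecture-24832` (helper lane, count-neutral).  The #41 TOP's standard family lives in `I(s, χ)` with
`χ = toHeckeCharacter L lam⁻¹`, `lam : C_L → S¹` conjugate-symplectic (`hlam`).  §1 discharges the two character letters of ★ (E7)∕(E7′)∕(E7″)'s CM heads:
* **`splitting_of_record`** — `∀ a, χ(a_L) = ε(a)` (`ε = quadraticHeckeCharCM L`; ★ `IsConjugateSymplectic.inv` + ★ `isOscillatorChar_toHeckeCharacter_iff`, `pow_one`);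
* **`norm_localComponent_of_record`** — `‖χ_w(x)‖ = 1` (★ `isUnitary_toHeckeCharacter`, `localComponent = χ ∘ localUnits`).
§2 then reads the three scalar letters at the record: **`aNorm_two_eq_localScalar_of_record`** (unramified place, `χ_w` unramified: value `vol·c_v`),
**`invLocalScalar_mul_aNorm_two_eq_of_record`** + **`differentiableOn_modifiedNormaliser_of_record`** (`ε`-unramified place, any `χ_w`: `c_v⁻¹·aNorm 2 = m_v`, `m_v` holomorphic on `{0<re}`),
**`differentiableOn_aNorm_two_of_record_of_ramified`** (`ε`-ramified place: `aNorm 2` holomorphic on `{0<re}`).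
Sources: [HarrisKudlaSweet1996, §1 (1.5), §6 (6.14)–(6.16)]; [KudlaSweet1997, §1]; [Liu2021, Def. 4.1, Def. 4.11]; [Harris2007, (1.3.4) p. 92].
HONEST LABEL.  Helper lemmas, count-neutral; `HC_CM` is proved only modulo the 7 printed citations (2 remaining named inputs:
hLiu418 = `stmt-HodgeConjecture-24832`, h413 = `stmt-HodgeConjecture-24833`) until rung 0 closes.
-/

set_option autoImplicit false
-- the mandated namespace repeats the single-problem summit's segment (`HodgeConjecture.HodgeConjecture`)
set_option linter.dupNamespace false

noncomputable section

open NumberField IsDedekindDomain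
open Literature.NumberTheory.GaloisRepresentations
open Literature.NumberTheory.Automorphic Literature.NumberTheory.Automorphic.UnitaryGroup Literature.NumberTheory.Automorphic.IdeleClassGroup
open Literature.RepresentationTheory.HarrisKudlaSweet1996 Literature.RepresentationTheory.Liu2021
open Summit.HodgeConjecture.HodgeConjecture.Cruxes.HLiu418.K2LiuLocalLFactorDefs
open Summit.HodgeConjecture.HodgeConjecture.Cruxes.HLiu418.K2LiuConjugateSymplecticInv
open Summit.HodgeConjecture.HodgeConjecture.Cruxes.HLiu418.K2LiuSiegelNormaliserTwoValue
open Summit.HodgeConjecture.HodgeConjecture.Cruxes.HLiu418.K2LiuSiegelNormaliserTwoRamified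
open Summit.HodgeConjecture.HodgeConjecture.Cruxes.HLiu418.K2LiuSiegelNormaliserTwoModified

namespace Summit.HodgeConjecture.HodgeConjecture.Cruxes.HLiu418.K2LiuSiegelNormaliserTwoOfRecord

variable (L : Type) [Field L] [NumberField L] [IsCMField L]

/-! ## §1 The two character letters at the record -/

/-- **`hχε` AT THE RECORD**: for `lam` conjugate-symplectic, `χ = toHeckeCharacter L lam⁻¹` satisfies `χ(a_L) = ε_{L∕L⁺}(a)` on `𝕀_{L⁺}` (★ HKS (1.5) at `m = 1`: `lam⁻¹` is conjugate-symplectic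
★ `IsConjugateSymplectic.inv`, ★ `isOscillatorChar_toHeckeCharacter_iff`). [cite: HarrisKudlaSweet1996, §1 (1.5)] [cite: Liu2021, Def. 4.1] -/
theorem splitting_of_record {lam : IdeleClassGroup L →ₜ* Circle} (hlam : IsConjugateSymplectic L lam) :
    ∀ a : ideleGroup ↥(maximalRealSubfield L),
      toHeckeCharacter L lam⁻¹ (AdeleRing.ideleBaseChange ↥(maximalRealSubfield L) L a) = quadraticHeckeCharCM L a := fun a => by
  have hspl : IsSplittingChar L 1 (toHeckeCharacter L lam⁻¹) := (isOscillatorChar_toHeckeCharacter_iff lam⁻¹).mpr (IsConjugateSymplectic.inv hlam)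
  rw [hspl a, pow_one]

/-- **`hχu`**: the local components of a unitary Hecke character take values of norm `1`. [cite: KudlaSweet1997, §1] -/
theorem norm_localComponent_of_isUnitary {K : Type} [Field K] [NumberField K] {χ : HeckeCharacter K} (hχ : χ.IsUnitary)
    (w : HeightOneSpectrum (𝓞 K)) (x : (w.adicCompletion K)ˣ) : ‖((χ.localComponent w x : ℂˣ) : ℂ)‖ = 1 := by
  rw [HeckeCharacter.localComponent_apply]
  exact hχ _

omit [IsCMField L] in
/-- **`hχu` AT THE RECORD**: `‖(toHeckeCharacter L lam⁻¹)_w(x)‖ = 1` for every `w ∣ v`. [cite: KudlaSweet1997, §1] -/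
theorem norm_localComponent_of_record (lam : IdeleClassGroup L →ₜ* Circle) (v : HeightOneSpectrum (𝓞 ↥(maximalRealSubfield L))) :
    ∀ (w : PlacesOver L v) (x : (w.1.adicCompletion L)ˣ), ‖(((toHeckeCharacter L lam⁻¹).localComponent w.1 x : ℂˣ) : ℂ)‖ = 1 :=
  fun w x => norm_localComponent_of_isUnitary (isUnitary_toHeckeCharacter L lam⁻¹) w.1 x

/-! ## §2 The three scalar letters at the record -/

variable (v : HeightOneSpectrum (𝓞 ↥(maximalRealSubfield L)))
  {π : v.adicCompletion ↥(maximalRealSubfield L)} (hπ : Valued.v π = WithZero.exp (-1 : ℤ))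
  (hπw : ∀ w : PlacesOver L v, Valued.v (toPlace v w π) = WithZero.exp (-1 : ℤ))

include hπ hπw in
/-- **(E7) AT THE RECORD**: at a place `v` unramified in `L` with `χ_w` unramified above `v`, `0 < re s`:
`aNorm 2 (χ_w)_{w∣v} vol s = vol·[(1−q_v^{−(2s+1)})(1−ε(ϖ_v)q_v^{−(2s+2)})]∕[(1−q_v^{−2s})(1−ε(ϖ_v)q_v^{−(2s−1)})]`, `χ = toHeckeCharacter L lam⁻¹`.
[cite: HarrisKudlaSweet1996, §6 (6.14)–(6.16)] [cite: Harris2007, (1.3.4) p. 92] -/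
theorem aNorm_two_eq_localScalar_of_record {lam : IdeleClassGroup L →ₜ* Circle} (hlam : IsConjugateSymplectic L lam)
    (hχur : ∀ (w : PlacesOver L v) (u : (w.1.adicCompletion L)ˣ), Valued.v (u : w.1.adicCompletion L) = 1 → (toHeckeCharacter L lam⁻¹).localComponent w.1 u = 1)
    (hunr : Algebra.IsUnramifiedIn (𝓞 L) v.asIdeal) (w₀ : PlacesOver L v) (vol : ℝ) {s : ℂ} (hs : 0 < s.re) :
    aNorm ↥(maximalRealSubfield L) L (IsCMField.complexConj L : L ≃ₐ[↥(maximalRealSubfield L)] L) v 2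
        (fun w : PlacesOver L v => (toHeckeCharacter L lam⁻¹).localComponent w.1) vol s =
      (vol : ℂ) *
        (((1 - (v.residueCard : ℂ) ^ (-(2 * s + 1))) * (1 - (quadraticHeckeCharCM L).valueAtUniformizer v * (v.residueCard : ℂ) ^ (-(2 * s + 2)))) /
          ((1 - (v.residueCard : ℂ) ^ (-(2 * s))) * (1 - (quadraticHeckeCharCM L).valueAtUniformizer v * (v.residueCard : ℂ) ^ (-(2 * s - 1))))) :=
  aNorm_two_localComponent_eq_localScalar_cm L v hπ hπw (toHeckeCharacter L lam⁻¹) (splitting_of_record L hlam) hχur hunr w₀ vol hs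

/-- **(E7″) AT THE RECORD**: at an `ε`-unramified place, `½ < re s`: `c_v(s)⁻¹ · aNorm 2 (χ_w)_{w∣v} vol s = m_v(s)` (no unramifiedness of the `χ_w` asked).
[cite: HarrisKudlaSweet1996, §6 (6.16)] [cite: KudlaSweet1997, §1] -/
theorem invLocalScalar_mul_aNorm_two_eq_of_record {lam : IdeleClassGroup L →ₜ* Circle} (hlam : IsConjugateSymplectic L lam)
    (hur : (quadraticHeckeCharCM L).IsUnramifiedAt v) (vol : ℝ) {s : ℂ} (hs : 1 / 2 < s.re) :
    ((1 - (v.residueCard : ℂ) ^ (-(2 * s))) * (1 - (quadraticHeckeCharCM L).valueAtUniformizer v * (v.residueCard : ℂ) ^ (-(2 * s - 1)))) /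
          ((1 - (v.residueCard : ℂ) ^ (-(2 * s + 1))) * (1 - (quadraticHeckeCharCM L).valueAtUniformizer v * (v.residueCard : ℂ) ^ (-(2 * s + 2)))) *
        aNorm ↥(maximalRealSubfield L) L (IsCMField.complexConj L : L ≃ₐ[↥(maximalRealSubfield L)] L) v 2
          (fun w : PlacesOver L v => (toHeckeCharacter L lam⁻¹).localComponent w.1) vol s =
      (vol : ℂ) * (((1 - (v.residueCard : ℂ) ^ (-(2 * s))) * (1 - (quadraticHeckeCharCM L).valueAtUniformizer v * (v.residueCard : ℂ) ^ (-(2 * s))) *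
            lEN ↥(maximalRealSubfield L) L (IsCMField.complexConj L : L ≃ₐ[↥(maximalRealSubfield L)] L) v
              (fun w : PlacesOver L v => (toHeckeCharacter L lam⁻¹).localComponent w.1) (2 * s)) /
        ((1 - (v.residueCard : ℂ) ^ (-(2 * s + 1))) * (1 - (quadraticHeckeCharCM L).valueAtUniformizer v * (v.residueCard : ℂ) ^ (-(2 * s + 1))) *
            lEN ↥(maximalRealSubfield L) L (IsCMField.complexConj L : L ≃ₐ[↥(maximalRealSubfield L)] L) v
              (fun w : PlacesOver L v => (toHeckeCharacter L lam⁻¹).localComponent w.1) (2 * s + 1))) :=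
  invLocalScalar_mul_aNorm_two_eq_cm L v (toHeckeCharacter L lam⁻¹) (splitting_of_record L hlam) (norm_localComponent_of_record L lam v) hur vol hs

/-- **(E7″) AT THE RECORD, holomorphy**: the modified normaliser `m_v` of `χ = toHeckeCharacter L lam⁻¹` is holomorphic on `{0 < re}` (any `lam`).
[cite: KudlaSweet1997, §1] [cite: HarrisKudlaSweet1996, §6 (6.16)] -/
theorem differentiableOn_modifiedNormaliser_of_record (lam : IdeleClassGroup L →ₜ* Circle) (vol : ℝ) :
    DifferentiableOn ℂ (fun s : ℂ =>
      (vol : ℂ) * (((1 - (v.residueCard : ℂ) ^ (-(2 * s))) * (1 - (quadraticHeckeCharCM L).valueAtUniformizer v * (v.residueCard : ℂ) ^ (-(2 * s))) *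
            lEN ↥(maximalRealSubfield L) L (IsCMField.complexConj L : L ≃ₐ[↥(maximalRealSubfield L)] L) v
              (fun w : PlacesOver L v => (toHeckeCharacter L lam⁻¹).localComponent w.1) (2 * s)) /
        ((1 - (v.residueCard : ℂ) ^ (-(2 * s + 1))) * (1 - (quadraticHeckeCharCM L).valueAtUniformizer v * (v.residueCard : ℂ) ^ (-(2 * s + 1))) *
            lEN ↥(maximalRealSubfield L) L (IsCMField.complexConj L : L ≃ₐ[↥(maximalRealSubfield L)] L) v
              (fun w : PlacesOver L v => (toHeckeCharacter L lam⁻¹).localComponent w.1) (2 * s + 1))))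
      {s : ℂ | 0 < s.re} :=
  differentiableOn_modifiedNormaliser_cm L v (toHeckeCharacter L lam⁻¹) (norm_localComponent_of_record L lam v) vol

/-- **(E7′) AT THE RECORD**: at an `ε`-RAMIFIED place, `s ↦ aNorm 2 (χ_w)_{w∣v} vol s` is holomorphic on `{0 < re}`, `χ = toHeckeCharacter L lam⁻¹`.
[cite: KudlaSweet1997, §1] [cite: HarrisKudlaSweet1996, §6 (6.16)] -/
theorem differentiableOn_aNorm_two_of_record_of_ramified {lam : IdeleClassGroup L →ₜ* Circle} (hlam : IsConjugateSymplectic L lam)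
    (hram : ¬ (quadraticHeckeCharCM L).IsUnramifiedAt v) (vol : ℝ) :
    DifferentiableOn ℂ (aNorm ↥(maximalRealSubfield L) L (IsCMField.complexConj L : L ≃ₐ[↥(maximalRealSubfield L)] L) v 2
      (fun w : PlacesOver L v => (toHeckeCharacter L lam⁻¹).localComponent w.1) vol) {s : ℂ | 0 < s.re} :=
  differentiableOn_aNorm_two_localComponent_cm_of_ramified L v (toHeckeCharacter L lam⁻¹) (splitting_of_record L hlam)
    (norm_localComponent_of_record L lam v) hram vol

end Summit.HodgeConjecture.HodgeConjecture.Cruxes.HLiu418.K2LiuSiegelNormaliserTwoOfRecord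

end
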